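import Summits.QuantumFields.YangMills.Theorems.LuscherReductionDressedRitzPolyakovLiftBlockPosition
import HarnessLib

/-!
# Route `LuscherReduction`, item `DressedRitz` (stmt-QuantumFields-20205), line «polyakovlift» — NEGATIVE ∕ LOCATED FACT for the block route to (o6)
# (standing crux disprover ym-cdisprove-20205-1, g13): the centre mismatch of the (o6) triangle is load-bearing at FIRST order and harmless at SECOND order

The LEAD's block-currency text `BlockPositionForL` (p588721) announces W4-A: `LiftPositionForL P ⟸ BlockPositionForL P ∧ BlockLeakageForL P` through the
cross door `BlockToFine.cross_door` (p588411) and the triangle `PolyakovLift.o6_of_block`, whose input `hmis : |X₀ − M̄|·|⟨u_i,u_l⟩| ≤ F` compares the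
door's centre `X₀ = m̄^L` (power of the mean FINE Rayleigh quotient) with the block clause (B6)'s centre `M̄ = (X̄_i + X̄_l)/2` (mean of the BLOCK quotients).

* LOCATED FACT (`shear_symmetrised_cross_eq_zero`): on the symmetric SHEAR `u_i = ψ₁ + p·ψ₂`, `u_l = p·ψ₁ + ψ₂` of an exact pair both the fine (o6) quantity
  `⟨u_i,Ku_l⟩ − m̄⟨u_i,u_l⟩` and the block (B6) quantity `⟨u_i,Pu_l⟩ − M̄⟨u_i,u_l⟩` VANISH identically while `⟨u_i,u_l⟩ = 2p‖·‖²/(1+p²)`: (o6) and (B6) are blind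
  to the symmetric shear, whose amplitude between ladder neighbours is limited by the block defects `≤ Cλ³` only to `p ≲ √(Cλ)/|Δε̂|`.  Hence a triangle that controls
  the centre mismatch at FIRST order — the tree's `PolyakovLift.centre_between`, `e^{−b}·min(X̄_i,X̄_l) ≤ X₀ ≤ max(X̄_i,X̄_l)`, i.e. `|X₀ − M̄| ≲ |X̄_i − X̄_l| ≍ λ₀^L·λ|Δε̂|` —
  delivers (o6) only at `(λ/L)·|⟨u_i,u_l⟩|/(‖u_i‖‖u_l‖)`: at tolerance `λ²/L` it NEEDS near-orthogonality `|⟨u_i,u_l⟩| ≤ cλ‖u_i‖‖u_l‖` (statics (o2)), which is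
  not a hypothesis of W4-A as announced.
* REPAIR (`centre_secondOrder`, `hmis_secondOrder`): the mismatch is in fact SECOND order — `X₀ ≤ M̄ ≤ exp(b + (L·s)²/2)·X₀`, `s = (m_i − m_l)/(m_i + m_l)`, from the
  doors (a)(b) alone (two-point power mean + `cosh x ≤ e^{x²/2}`); with `b = 15Cλ³` and `L·s = O(λ)` (from (B5) and the one-site level package) the factor is `O(λ²)`
  and Cauchy–Schwarz on `⟨u_i,u_l⟩` suffices: W4-A needs NO statics input.

Pure real lemmas; they refute nothing and close no stub.  HONEST FRAMING: bookkeeping for the CONDITIONAL femto rung R2b1 (crux `DressedRitz` of route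
`LuscherReduction`); nothing here bears on infinite volume, the continuum limit or the Clay mass gap.
References: M. Lüscher, U. Wolff, NPB 339 (1990) 222 [cite: LuscherWolff1990] (symmetrised couplings of a Ritz pair); M. Lüscher, NPB 219 (1983) 233 [cite: Luscher1983, §3].
-/

set_option autoImplicit false

noncomputable section

namespace Summit.QuantumFields.YangMills.Theorems.FemtoTransferGap.PolyakovLift.Negative

open Real

/-- `((1+s)^L + (1−s)^L)/2 ≤ exp((L·s)²/2)` for `|s| ≤ 1` (`1 ± s ≤ e^{±s}`, then `cosh x ≤ e^{x²/2}`). [folklore] -/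
theorem half_pow_add_pow_le_exp {s : ℝ} (hs1 : s ≤ 1) (hs2 : -1 ≤ s) (L : ℕ) :
    ((1 + s) ^ L + (1 - s) ^ L) / 2 ≤ Real.exp (((L : ℝ) * s) ^ 2 / 2) := by
  have h1 : (1 + s) ^ L ≤ Real.exp ((L : ℝ) * s) := by
    calc (1 + s) ^ L ≤ Real.exp s ^ L := pow_le_pow_left₀ (by linarith) (by linarith [Real.add_one_le_exp s]) L
      _ = Real.exp ((L : ℝ) * s) := by rw [← Real.exp_nat_mul]
  have h2 : (1 - s) ^ L ≤ Real.exp (-((L : ℝ) * s)) := by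
    calc (1 - s) ^ L ≤ Real.exp (-s) ^ L := pow_le_pow_left₀ (by linarith) (by linarith [Real.add_one_le_exp (-s)]) L
      _ = Real.exp (-((L : ℝ) * s)) := by rw [← Real.exp_nat_mul]; ring_nf
  calc ((1 + s) ^ L + (1 - s) ^ L) / 2 ≤ (Real.exp ((L : ℝ) * s) + Real.exp (-((L : ℝ) * s))) / 2 := by linarith
    _ = Real.cosh ((L : ℝ) * s) := (Real.cosh_eq _).symm
    _ ≤ Real.exp (((L : ℝ) * s) ^ 2 / 2) := Real.cosh_le_exp_half_sq _

/-- Two-point power mean: `((y+y')/2)^L ≤ (y^L + y'^L)/2` for `y, y' ≥ 0`. [folklore] -/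
theorem mean_pow_le_half_pow_add_pow {y y' : ℝ} (hy : 0 ≤ y) (hy' : 0 ≤ y') (L : ℕ) :
    ((y + y') / 2) ^ L ≤ (y ^ L + y' ^ L) / 2 := by
  have h := (convexOn_pow L).2 (Set.mem_Ici.2 hy) (Set.mem_Ici.2 hy') (by norm_num : (0 : ℝ) ≤ 1 / 2) (by norm_num : (0 : ℝ) ≤ 1 / 2)
    (by norm_num : (1 / 2 : ℝ) + 1 / 2 = 1)
  simp only [smul_eq_mul] at h
  calc ((y + y') / 2) ^ L = (1 / 2 * y + 1 / 2 * y') ^ L := by ring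
    _ ≤ 1 / 2 * y ^ L + 1 / 2 * y' ^ L := h
    _ = (y ^ L + y' ^ L) / 2 := by ring

/-- `(y^L + y'^L)/2 ≤ exp((L·s)²/2)·((y+y')/2)^L`, `s = (y − y')/(y + y')`, for `y, y' > 0`. [folklore] -/
theorem half_pow_add_pow_le_exp_mul_mean_pow {y y' : ℝ} (hy : 0 < y) (hy' : 0 < y') (L : ℕ) :
    (y ^ L + y' ^ L) / 2 ≤ Real.exp (((L : ℝ) * ((y - y') / (y + y'))) ^ 2 / 2) * ((y + y') / 2) ^ L := by
  set c : ℝ := (y + y') / 2 with hc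
  set s : ℝ := (y - y') / (y + y') with hs
  have hcpos : 0 < c := by rw [hc]; linarith
  have hsum : 0 < y + y' := by linarith
  have hy_eq : y = c * (1 + s) := by rw [hc, hs]; field_simp; ring
  have hy'_eq : y' = c * (1 - s) := by rw [hc, hs]; field_simp; ring
  have hs1 : s ≤ 1 := by rw [hs, div_le_one hsum]; linarith
  have hs2 : -1 ≤ s := by rw [hs, le_div_iff₀ hsum]; linarith
  have key := half_pow_add_pow_le_exp hs1 hs2 L
  calc (y ^ L + y' ^ L) / 2 = c ^ L * (((1 + s) ^ L + (1 - s) ^ L) / 2) := by rw [hy_eq, hy'_eq, mul_pow, mul_pow]; ring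
    _ ≤ c ^ L * Real.exp (((L : ℝ) * s) ^ 2 / 2) := mul_le_mul_of_nonneg_left key (pow_nonneg hcpos.le L)
    _ = Real.exp (((L : ℝ) * s) ^ 2 / 2) * c ^ L := mul_comm _ _

/-- ★ **SECOND-ORDER CENTRE MISMATCH.**  If `y^L ≤ X ≤ e^b·y^L` and `y'^L ≤ X' ≤ e^b·y'^L` (doors (a)(b) of `FemtoTransferGapBlockToFine` for the two channels,
`y, y'` the fine Rayleigh quotients, `X, X'` the block ones) then the fine centre power `X₀ = ((y+y')/2)^L` and the block centre `M̄ = (X+X')/2` satisfy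
`X₀ ≤ M̄ ≤ exp(b + (L·s)²/2)·X₀`, `s = (y − y')/(y + y')`.  (Compare `PolyakovLift.centre_between`: first order.) [cite: LuscherWolff1990] -/
theorem centre_secondOrder {y y' X X' b : ℝ} {L : ℕ} (hy : 0 < y) (hy' : 0 < y')
    (ha : y ^ L ≤ X) (hb : X ≤ Real.exp b * y ^ L) (ha' : y' ^ L ≤ X') (hb' : X' ≤ Real.exp b * y' ^ L) :
    ((y + y') / 2) ^ L ≤ (X + X') / 2 ∧
      (X + X') / 2 ≤ Real.exp (b + ((L : ℝ) * ((y - y') / (y + y'))) ^ 2 / 2) * ((y + y') / 2) ^ L := by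
  constructor
  · calc ((y + y') / 2) ^ L ≤ (y ^ L + y' ^ L) / 2 := mean_pow_le_half_pow_add_pow hy.le hy'.le L
      _ ≤ (X + X') / 2 := by linarith
  · have hE : 0 < Real.exp b := Real.exp_pos b
    calc (X + X') / 2 ≤ Real.exp b * ((y ^ L + y' ^ L) / 2) := by nlinarith
      _ ≤ Real.exp b * (Real.exp (((L : ℝ) * ((y - y') / (y + y'))) ^ 2 / 2) * ((y + y') / 2) ^ L) :=
          mul_le_mul_of_nonneg_left (half_pow_add_pow_le_exp_mul_mean_pow hy hy' L) hE.le
      _ = Real.exp (b + ((L : ℝ) * ((y - y') / (y + y'))) ^ 2 / 2) * ((y + y') / 2) ^ L := by rw [Real.exp_add]; ring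

/-- ★ The `hmis` input of `PolyakovLift.o6_of_block` WITHOUT statics: `|X₀ − M̄|·|N| ≤ (exp(b + (L·s)²/2) − 1)·X₀·|N|` for ANY overlap `N = ⟨u_i,u_l⟩`
(then `|N| ≤ ‖u_i‖‖u_l‖` by Cauchy–Schwarz; with `b = 15Cλ³`, `L·s = O(λ)` the factor is `O(λ²)`). [folklore] -/
theorem hmis_secondOrder {y y' X X' b N : ℝ} {L : ℕ} (hy : 0 < y) (hy' : 0 < y')
    (ha : y ^ L ≤ X) (hb : X ≤ Real.exp b * y ^ L) (ha' : y' ^ L ≤ X') (hb' : X' ≤ Real.exp b * y' ^ L) :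
    |((y + y') / 2) ^ L - (X + X') / 2| * |N| ≤
      (Real.exp (b + ((L : ℝ) * ((y - y') / (y + y'))) ^ 2 / 2) - 1) * ((y + y') / 2) ^ L * |N| := by
  obtain ⟨h1, h2⟩ := centre_secondOrder hy hy' ha hb ha' hb'
  have hX0 : 0 ≤ ((y + y') / 2) ^ L := pow_nonneg (by linarith) L
  refine mul_le_mul_of_nonneg_right ?_ (abs_nonneg N)
  rw [abs_sub_comm, abs_of_nonneg (by linarith)]
  linarith

/-- FIRST ORDER IS NOT ENOUGH (the located fact, as numbers): on the symmetric SHEAR of an exact two-level pair — dressed `u_i = ψ₁ + p·ψ₂`, `u_l = p·ψ₁ + ψ₂`,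
eigenvalues `κ₁, κ₂`, block `P = K^L` with `K ψ_a = κ_a ψ_a` — the symmetrised FINE cross `⟨u_i,Ku_l⟩ − m̄⟨u_i,u_l⟩` and the symmetrised BLOCK cross
`⟨u_i,Pu_l⟩ − M̄⟨u_i,u_l⟩` both VANISH IDENTICALLY while the overlap is `⟨u_i,u_l⟩ = 2p` — (o6) and (B6) are blind to the symmetric shear (near-orthogonality is
statics' business), so a triangle whose mismatch term is first order, `|X₀ − M̄| ≍ |X̄_i − X̄_l|`, pays `λ·|⟨u_i,u_l⟩|`, i.e. `λ^{3/2}` at the shear amplitude `p ≍ √λ`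
that block defects `≤ Cλ³` still allow between ladder neighbours (`D ≈ p²(λΔε̂)²`).  Pure real identities (`n = 1 + p²` for both vectors). [folklore] -/
theorem shear_symmetrised_cross_eq_zero (κ₁ κ₂ p : ℝ) (L : ℕ) :
    let n : ℝ := 1 + p ^ 2
    let mi : ℝ := (κ₁ + p ^ 2 * κ₂) / n
    let ml : ℝ := (p ^ 2 * κ₁ + κ₂) / n
    let Xi : ℝ := (κ₁ ^ L + p ^ 2 * κ₂ ^ L) / n
    let Xl : ℝ := (p ^ 2 * κ₁ ^ L + κ₂ ^ L) / n
    (p * κ₁ + p * κ₂) - (mi + ml) / 2 * (2 * p) = 0 ∧ (p * κ₁ ^ L + p * κ₂ ^ L) - (Xi + Xl) / 2 * (2 * p) = 0 := by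
  have hn : (1 + p ^ 2 : ℝ) ≠ 0 := by positivity
  constructor <;> · field_simp; ring

end Summit.QuantumFields.YangMills.Theorems.FemtoTransferGap.PolyakovLift.Negative

end
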